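import Literature.NumberTheory.ModularForms.DedekindSumRademacherPhi
import Mathlib.Algebra.BigOperators.Field
import Mathlib.Algebra.Group.Int.Units
import Mathlib.RingTheory.Coprime.Lemmas
import HarnessLib

/-!
# The reciprocity law for Dedekind sums (proved) and the integrality of Rademacher's `Φ`

Topic `Literature/NumberTheory/ModularForms`; namespace `Literature.NumberTheory.ModularForms`.
Theorem-only sequel of `DedekindSumRademacherPhi` (defs `dedekindSaw`, `dedekindSum`,
`rademacherPhi(SL)`, `eisensteinPsi(SL)`, named statement `DedekindSumReciprocity`).

* **`DedekindSumReciprocity_holds : DedekindSumReciprocity`** — the RECIPROCITY LAW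
  `12hk·s(h,k) + 12kh·s(k,h) = h² + k² − 3hk + 1` for coprime `h, k > 0`, PROVED along the
  arithmetic proof of Rademacher–Whiteman printed in [cite: Apostol1990, §3.8 (proof of Thm. 3.7)]:
  the residues `hr mod k` permute `0, …, k−1` (`∑ ((hr/k)) = 0`, `∑ ((hr/k))² = ∑ ((r/k))²`,
  eq. (32)–(33)); Apostol's form (30) and eq. (36) `12k·s(h,k) = 2h(k−1)(2k−1) − 12∑ r[hr/k] − 3k(k−1)`
  (`dedekindSum_eq_sum_div_mul_dedekindSaw`, `twelve_mul_dedekindSum`); and the count (34)–(35)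
  `∑_r [hr/k]([hr/k]+1) + 2∑_v v[kv/h] = h(h−1)(k−1)` (`sum_floor_sq_add_floor`, by double counting
  the lattice points `{(r,v) : kv < hr}`); the final step is linear algebra over `ℚ`.
  Usable forms `dedekindSum_reciprocity`, `dedekindSum_add_dedekindSum_swap` (RG's (4)).
* `six_mul_dedekindSum_mem_int` (+ `_of_isCoprime`) — "`6k·s(h,k)` is an integer"
  [cite: Apostol1990, Thm. 3.8] = weak form of [cite: RademacherGrosswald1972, Ch. 3 Thm. 2].
* `natAbs_dvd_add_sub_twelve_mul_dedekindSum` — eq. (61): `12|c|·s(d,|c|) ≡ a + d (mod |c|)` for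
  `ad − bc = 1`; **`rademacherPhi_mem_int`**, **`rademacherPhiSL_mem_int`** — `Φ(M) ∈ ℤ` on `SL₂(ℤ)`
  [cite: RademacherGrosswald1972, Ch. 4 A, pp. 49–50]; `eisensteinPsi_mem_int` — `Ψ_t(M) ∈ ℤ` on
  `Γ₀(t)`.

No new definitions, no named facts; net debt −1 (`DedekindSumReciprocity` discharged).

## References

* [Apostol1990] T. M. Apostol, *Modular Functions and Dirichlet Series in Number Theory*, 2nd ed.,
  GTM 41 (1990), §§3.7–3.9.
* [RademacherGrosswald1972] H. Rademacher, E. Grosswald, *Dedekind Sums*, Carus Math. Monographs 16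
  (1972), Ch. 2 Thm. 1, Ch. 3 Thm. 2, Ch. 4 A.
-/

open scoped MatrixGroups

namespace Literature.NumberTheory.ModularForms

/-! ### Arithmetic of `s(h,k)` for coprime `h, k`: Apostol's (30) and (36), the denominator
(Thm. 3.8 / RG Thm. 2), and the RECIPROCITY LAW (Thm. 3.7, arithmetic proof of Rademacher–Whiteman) -/

section Reciprocity

open Finset

/-- `∑_{r<k} r = k(k−1)/2` in `ℚ`. [folklore] -/
private theorem sum_range_natCast (k : ℕ) :
    ∑ r ∈ range k, (r : ℚ) = (k : ℚ) * ((k : ℚ) - 1) / 2 := by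
  induction k with
  | zero => simp
  | succ n ih => rw [sum_range_succ, ih]; push_cast; ring

/-- `∑_{r<k} r² = k(k−1)(2k−1)/6` in `ℚ`. [folklore] -/
private theorem sum_range_natCast_sq (k : ℕ) :
    ∑ r ∈ range k, ((r : ℚ)) ^ 2 = (k : ℚ) * ((k : ℚ) - 1) * (2 * (k : ℚ) - 1) / 6 := by
  induction k with
  | zero => simp
  | succ n ih => rw [sum_range_succ, ih]; push_cast; ring

/-- For `(h, k) = 1` the map `r ↦ h r mod k` is injective on `0, …, k − 1`. [folklore] -/
private theorem injOn_mul_mod {h k : ℕ} (hc : Nat.Coprime h k) :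
    Set.InjOn (fun r => h * r % k) (range k : Set ℕ) := by
  intro r hr r' hr' e
  have hm : h * r ≡ h * r' [MOD k] := e
  exact Nat.ModEq.eq_of_lt_of_lt (Nat.ModEq.cancel_left_of_coprime hc.symm hm)
    (mem_range.mp (mem_coe.mp hr)) (mem_range.mp (mem_coe.mp hr'))

/-- For `(h, k) = 1`, `r ↦ h r mod k` permutes the residues `0, …, k − 1`. [folklore] -/
private theorem image_mul_mod_range {h k : ℕ} (hk : 0 < k) (hc : Nat.Coprime h k) :
    (range k).image (fun r => h * r % k) = range k := by
  apply eq_of_subset_of_card_le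
  · intro x hx
    rw [mem_image] at hx
    obtain ⟨r, -, rfl⟩ := hx
    exact mem_range.mpr (Nat.mod_lt _ hk)
  · rw [card_image_of_injOn (injOn_mul_mod hc), card_range]

/-- Reindexing a sum over a residue system by `r ↦ h r mod k`, `(h, k) = 1` ("when `μ` runs through a
full residue system modulo `k`, so does `hμ`"). [folklore] -/
private theorem sum_mul_mod_eq {h k : ℕ} (hk : 0 < k) (hc : Nat.Coprime h k) (f : ℕ → ℚ) :
    ∑ r ∈ range k, f (h * r % k) = ∑ r ∈ range k, f r := by
  rw [← sum_image (injOn_mul_mod hc), image_mul_mod_range hk hc]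

/-- `h r = k ⌊hr/k⌋ + (hr mod k)` in `ℚ`. [folklore] -/
private theorem natCast_mul_eq_div_add_mod (h r k : ℕ) :
    (h : ℚ) * r = (k : ℚ) * ((h * r / k : ℕ) : ℚ) + ((h * r % k : ℕ) : ℚ) := by
  exact_mod_cast (Nat.div_add_mod (h * r) k).symm

/-- `((n + x)) = ((x))` for `n ∈ ℕ`. [folklore] -/
private theorem dedekindSaw_natCast_add' (n : ℕ) (x : ℚ) : dedekindSaw ((n : ℚ) + x) = dedekindSaw x := by
  simpa using dedekindSaw_intCast_add (K := ℚ) (n : ℤ) x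

/-- `((h r / k)) = (((h r mod k)/k))` (periodicity). [folklore] -/
private theorem dedekindSaw_mul_div (h r k : ℕ) (hk : 0 < k) :
    dedekindSaw ((h : ℚ) * r / k) = dedekindSaw (((h * r % k : ℕ) : ℚ) / k) := by
  have hk' : (k : ℚ) ≠ 0 := by exact_mod_cast hk.ne'
  have e : (h : ℚ) * r / k = ((h * r / k : ℕ) : ℚ) + ((h * r % k : ℕ) : ℚ) / k := by
    rw [natCast_mul_eq_div_add_mod h r k]
    field_simp
  rw [e, dedekindSaw_natCast_add']

/-- `((ρ/k)) = ρ/k − ½` for `0 < ρ < k`, and `((0/k)) = 0`. [folklore] -/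
private theorem dedekindSaw_natCast_div {ρ k : ℕ} (hρ : ρ < k) :
    dedekindSaw ((ρ : ℚ) / k) = if ρ = 0 then 0 else (ρ : ℚ) / k - 1 / 2 := by
  split_ifs with h0
  · subst h0; simp
  · have hk : (0 : ℚ) < k := by exact_mod_cast (Nat.zero_le ρ).trans_lt hρ
    apply dedekindSaw_of_pos_of_lt_one
    · exact div_pos (by exact_mod_cast Nat.pos_of_ne_zero h0) hk
    · rw [div_lt_one hk]; exact_mod_cast hρ

/-- `∑_{r mod k} ((r/k)) = 0` ("since `((x))` is periodic and odd"). [cite: Apostol1990, §3.7 (display before eq. (31))] -/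
theorem sum_dedekindSaw_div_eq_zero {k : ℕ} (hk : 0 < k) :
    ∑ r ∈ range k, dedekindSaw ((r : ℚ) / k) = 0 := by
  obtain ⟨n, rfl⟩ : ∃ n, k = n + 1 := ⟨k - 1, (Nat.sub_add_cancel hk).symm⟩
  rw [sum_range_succ']
  have hk' : ((n + 1 : ℕ) : ℚ) ≠ 0 := by exact_mod_cast hk.ne'
  have e : ∀ i ∈ range n, dedekindSaw (((i + 1 : ℕ) : ℚ) / ((n + 1 : ℕ) : ℚ)) =
      ((i + 1 : ℕ) : ℚ) / ((n + 1 : ℕ) : ℚ) - 1 / 2 := by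
    intro i hi
    rw [dedekindSaw_natCast_div (by simpa using mem_range.mp hi), if_neg (Nat.succ_ne_zero i)]
  rw [sum_congr rfl e, sum_sub_distrib, ← sum_div]
  simp only [Nat.cast_zero, zero_div, dedekindSaw_zero, add_zero, sum_const, card_range,
    nsmul_eq_mul]
  have hs : ∑ i ∈ range n, ((i + 1 : ℕ) : ℚ) = ((n : ℚ) + 1) * n / 2 := by
    have := sum_range_natCast (n + 1)
    rw [sum_range_succ'] at this
    push_cast at this ⊢
    linarith
  rw [hs]
  push_cast
  field_simp
  ring

/-- `∑_{r mod k} ((hr/k)) = 0` for `(h, k) = 1`. [cite: Apostol1990, §3.7 (display before eq. (31))] -/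
theorem sum_dedekindSaw_mul_div_eq_zero {h k : ℕ} (hk : 0 < k) (hc : Nat.Coprime h k) :
    ∑ r ∈ range k, dedekindSaw ((h : ℚ) * r / k) = 0 := by
  rw [sum_congr rfl fun r _ => dedekindSaw_mul_div h r k hk,
    sum_mul_mod_eq hk hc (fun ρ => dedekindSaw ((ρ : ℚ) / k)), sum_dedekindSaw_div_eq_zero hk]

/-- **Apostol's form (30)**: for `(h, k) = 1`,
`s(h,k) = ∑_{r=1}^{k-1} (r/k)·((hr/k)) = ∑_{r=1}^{k−1} (r/k)(hr/k − [hr/k] − ½)` (here summed over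
`r = 0, …, k − 1`, the `r = 0` term vanishing). [cite: Apostol1990, §3.7 eq. (30)–(31)] -/
theorem dedekindSum_eq_sum_div_mul_dedekindSaw {h k : ℕ} (hk : 0 < k) (hc : Nat.Coprime h k) :
    dedekindSum h k = ∑ r ∈ range k, (r : ℚ) / k * dedekindSaw ((h : ℚ) * r / k) := by
  have e1 : dedekindSum h k =
      ∑ r ∈ range k, ((r : ℚ) / k - 1 / 2) * dedekindSaw ((h : ℚ) * r / k) := by
    rw [dedekindSum_def]
    push_cast
    refine sum_congr rfl fun r hr => ?_
    rcases Nat.eq_zero_or_pos r with rfl | hr0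
    · simp
    · rw [dedekindSaw_natCast_div (mem_range.mp hr), if_neg hr0.ne']
  rw [e1]
  have e2 : ∑ r ∈ range k, ((r : ℚ) / k - 1 / 2) * dedekindSaw ((h : ℚ) * r / k) =
      ∑ r ∈ range k, (r : ℚ) / k * dedekindSaw ((h : ℚ) * r / k) -
        1 / 2 * ∑ r ∈ range k, dedekindSaw ((h : ℚ) * r / k) := by
    rw [mul_sum, ← sum_sub_distrib]
    exact sum_congr rfl fun r _ => by ring
  rw [e2, sum_dedekindSaw_mul_div_eq_zero hk hc, mul_zero, sub_zero]

/-- **Apostol's eq. (36), doubled** (first display in the proof of Thm. 3.9): for `(h, k) = 1`,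
`12k·s(h,k) = 2h(k−1)(2k−1) − 12 ∑_{r=1}^{k−1} r[hr/k] − 3k(k−1)`.
[cite: Apostol1990, Thm. 3.9 (proof, first display) and eq. (36)] -/
theorem twelve_mul_dedekindSum {h k : ℕ} (hk : 0 < k) (hc : Nat.Coprime h k) :
    12 * (k : ℚ) * dedekindSum h k =
      2 * h * ((k : ℚ) - 1) * (2 * k - 1)
        - 12 * (∑ r ∈ range k, (r : ℚ) * ((h * r / k : ℕ) : ℚ)) - 3 * k * ((k : ℚ) - 1) := by
  have hk' : (k : ℚ) ≠ 0 := by exact_mod_cast hk.ne'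
  -- pointwise: k² · (r/k)((hr/k)) = h r² − k·r[hr/k] − (k/2) r
  have key : ∀ r ∈ range k, (k : ℚ) ^ 2 * ((r : ℚ) / k * dedekindSaw ((h : ℚ) * r / k)) =
      h * (r : ℚ) ^ 2 - k * ((r : ℚ) * ((h * r / k : ℕ) : ℚ)) - k / 2 * r := by
    intro r hr
    rw [dedekindSaw_mul_div h r k hk, dedekindSaw_natCast_div (Nat.mod_lt _ hk)]
    have eρ : ((h * r % k : ℕ) : ℚ) = (h : ℚ) * r - k * ((h * r / k : ℕ) : ℚ) := by
      linear_combination -natCast_mul_eq_div_add_mod h r k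
    split_ifs with h0
    · -- `k ∣ h r` forces `r = 0` (coprimality, `r < k`)
      have hdvd : k ∣ r := by
        have : k ∣ h * r := Nat.dvd_of_mod_eq_zero h0
        exact (Nat.Coprime.dvd_of_dvd_mul_left hc.symm this)
      have hr0 : r = 0 := Nat.eq_zero_of_dvd_of_lt hdvd (mem_range.mp hr)
      subst hr0
      simp
    · rw [eρ]
      field_simp
      try ring
  calc 12 * (k : ℚ) * dedekindSum h k
      = 12 / k * ((k : ℚ) ^ 2 * dedekindSum h k) := by field_simp
    _ = 12 / k * ∑ r ∈ range k, (k : ℚ) ^ 2 * ((r : ℚ) / k * dedekindSaw ((h : ℚ) * r / k)) := by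
        rw [dedekindSum_eq_sum_div_mul_dedekindSaw hk hc, mul_sum]
    _ = 12 / k * ∑ r ∈ range k,
          (h * (r : ℚ) ^ 2 - k * ((r : ℚ) * ((h * r / k : ℕ) : ℚ)) - k / 2 * r) := by
        rw [sum_congr rfl key]
    _ = 12 / k * (h * ∑ r ∈ range k, (r : ℚ) ^ 2
          - k * ∑ r ∈ range k, (r : ℚ) * ((h * r / k : ℕ) : ℚ)
          - k / 2 * ∑ r ∈ range k, (r : ℚ)) := by
        rw [sum_sub_distrib, sum_sub_distrib, mul_sum, mul_sum, mul_sum]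
    _ = _ := by
        rw [sum_range_natCast_sq, sum_range_natCast]
        field_simp
        ring

/-- **The denominator of `s(h,k)`** (weak form of RG Thm. 2 / first sentence of Apostol's Thm. 3.8):
"The number `6k·s(h, k)` is an integer" (for `(h, k) = 1`). [cite: Apostol1990, Thm. 3.8]
[cite: RademacherGrosswald1972, Ch. 3 Thm. 2] -/
theorem six_mul_dedekindSum_mem_int {h k : ℕ} (hk : 0 < k) (hc : Nat.Coprime h k) :
    ∃ z : ℤ, 6 * (k : ℚ) * dedekindSum h k = z := by
  have e := twelve_mul_dedekindSum hk hc
  obtain ⟨m, hm⟩ : ∃ m : ℕ, k * (k - 1) = 2 * m := by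
    have : Even (k * (k - 1)) := Nat.even_mul_pred_self k
    obtain ⟨m, hm⟩ := this
    exact ⟨m, by omega⟩
  have hm' : (k : ℚ) * ((k : ℚ) - 1) = 2 * m := by
    have h1 : ((k * (k - 1) : ℕ) : ℚ) = ((2 * m : ℕ) : ℚ) := by rw [hm]
    rw [Nat.cast_mul, Nat.cast_sub hk] at h1
    push_cast at h1
    exact h1
  set A : ℕ := ∑ r ∈ range k, r * (h * r / k) with hA
  have hA' : (A : ℚ) = ∑ r ∈ range k, (r : ℚ) * ((h * r / k : ℕ) : ℚ) := by simp [hA]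
  refine ⟨h * (k - 1) * (2 * k - 1) - 6 * A - 3 * m, ?_⟩
  push_cast [Nat.cast_sub hk]
  rw [hA']
  linear_combination e / 2 - 3 / 2 * hm'

/-- The denominator statement for an integer first argument: `6k·s(h,k) ∈ ℤ` whenever
`gcd(h, k) = 1`. [cite: Apostol1990, Thm. 3.8] [cite: RademacherGrosswald1972, Ch. 3 Thm. 2] -/
theorem six_mul_dedekindSum_mem_int_of_isCoprime {h : ℤ} {k : ℕ} (hk : 0 < k)
    (hc : IsCoprime h (k : ℤ)) : ∃ z : ℤ, 6 * (k : ℚ) * dedekindSum h k = z := by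
  have hk0 : (k : ℤ) ≠ 0 := by exact_mod_cast hk.ne'
  set h₀ : ℤ := h % k with hh₀
  have h0nn : 0 ≤ h₀ := Int.emod_nonneg _ hk0
  have hdecomp : h = h₀ + k * (h / k) := (Int.emod_add_mul_ediv h k).symm
  have hc' : IsCoprime h₀ (k : ℤ) := by
    rw [hdecomp] at hc
    exact IsCoprime.add_mul_left_left_iff.mp hc
  have hnat : (h₀.toNat : ℤ) = h₀ := Int.toNat_of_nonneg h0nn
  have hcn : Nat.Coprime h₀.toNat k := Nat.isCoprime_iff_coprime.mp (by rw [hnat]; exact hc')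
  obtain ⟨z, hz⟩ := six_mul_dedekindSum_mem_int hk hcn
  refine ⟨z, ?_⟩
  rw [← dedekindSum_emod h k, ← hh₀, ← hnat]
  exact_mod_cast hz

/-! #### The lattice-point count behind Apostol's eq. (35) -/

/-- For `0 < r < k`, `(h, k) = 1`: `{v < h : k v < h r} = {0, …, [hr/k]}`. [folklore] -/
private theorem filter_lt_eq_range {h k r : ℕ} (hh : 0 < h) (hk : 0 < k) (hc : Nat.Coprime h k)
    (hr0 : 0 < r) (hrk : r < k) :
    (range h).filter (fun v => k * v < h * r) = range (h * r / k + 1) := by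
  ext v
  simp only [mem_filter, mem_range]
  constructor
  · rintro ⟨-, hv⟩
    have : v ≤ h * r / k := (Nat.le_div_iff_mul_le hk).mpr (by rw [Nat.mul_comm]; exact hv.le)
    omega
  · intro hv
    have hvq : v ≤ h * r / k := by omega
    have hq : h * r / k < h := (Nat.div_lt_iff_lt_mul hk).mpr (Nat.mul_lt_mul_of_pos_left hrk hh)
    refine ⟨lt_of_le_of_lt hvq hq, ?_⟩
    have hle : k * v ≤ h * r := by
      calc k * v ≤ k * (h * r / k) := Nat.mul_le_mul_left _ hvq
        _ ≤ h * r := Nat.mul_div_le _ _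
    rcases hle.lt_or_eq with hlt | heq
    · exact hlt
    · exfalso
      have hdvd : k ∣ h * r := ⟨v, heq.symm⟩
      have : k ∣ r := Nat.Coprime.dvd_of_dvd_mul_left hc.symm hdvd
      exact absurd (Nat.eq_zero_of_dvd_of_lt this hrk) hr0.ne'

/-- For `r < k`, `(h,k) = 1`: `[hr/k]² + [hr/k] = 2 ∑_{v < h, kv < hr} v`. [folklore] -/
private theorem sq_add_eq_two_mul_sum_filter {h k r : ℕ} (hh : 0 < h) (hk : 0 < k)
    (hc : Nat.Coprime h k) (hrk : r < k) :
    (h * r / k) ^ 2 + h * r / k = 2 * ∑ v ∈ (range h).filter (fun v => k * v < h * r), v := by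
  rcases Nat.eq_zero_or_pos r with rfl | hr0
  · simp
  · rw [filter_lt_eq_range hh hk hc hr0 hrk, mul_comm 2, sum_range_id_mul_two, Nat.add_sub_cancel]
    ring

/-- For `v < h`: `#{r < k : k v < h r} + ([kv/h] + 1) = k`. [folklore] -/
private theorem card_filter_lt_add {h k v : ℕ} (hh : 0 < h) (hk : 0 < k) (hv : v < h) :
    ((range k).filter (fun r => k * v < h * r)).card + (k * v / h + 1) = k := by
  have hneg : (range k).filter (fun r => ¬ k * v < h * r) = range (k * v / h + 1) := by
    ext r
    simp only [mem_filter, mem_range, not_lt]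
    constructor
    · rintro ⟨-, hr⟩
      have : r ≤ k * v / h := (Nat.le_div_iff_mul_le hh).mpr (by rw [Nat.mul_comm]; exact hr)
      omega
    · intro hr
      have hrq : r ≤ k * v / h := by omega
      have hq : k * v / h < k := (Nat.div_lt_iff_lt_mul hh).mpr (Nat.mul_lt_mul_of_pos_left hv hk)
      refine ⟨lt_of_le_of_lt hrq hq, ?_⟩
      calc h * r ≤ h * (k * v / h) := Nat.mul_le_mul_left _ hrq
        _ ≤ k * v := Nat.mul_div_le _ _
  have := card_filter_add_card_filter_not (s := range k) (fun r => k * v < h * r)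
  rw [hneg, card_range, card_range] at this
  exact this

/-- **The count behind Apostol's eq. (35)** (collecting the terms with `[hr/k]` fixed): for coprime
`h, k ≥ 1`, `∑_{r=1}^{k−1} [hr/k]([hr/k] + 1) + 2 ∑_{v=1}^{h−1} v[kv/h] = h(h−1)(k−1)`.
[cite: Apostol1990, Thm. 3.7 (proof, eq. (35))] -/
theorem sum_floor_sq_add_floor {h k : ℕ} (hh : 0 < h) (hk : 0 < k) (hc : Nat.Coprime h k) :
    ∑ r ∈ range k, ((h * r / k) ^ 2 + h * r / k) + 2 * ∑ v ∈ range h, v * (k * v / h) =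
      h * (h - 1) * (k - 1) := by
  -- Step 1: `∑_r ([hr/k]² + [hr/k]) = 2 ∑_v v · #{r < k : kv < hr}`
  have step1 : ∑ r ∈ range k, ((h * r / k) ^ 2 + h * r / k) =
      2 * ∑ v ∈ range h, v * ((range k).filter (fun r => k * v < h * r)).card := by
    rw [sum_congr rfl fun r hr => sq_add_eq_two_mul_sum_filter hh hk hc (mem_range.mp hr),
      ← mul_sum]
    congr 1
    simp_rw [sum_filter]
    rw [sum_comm]
    refine sum_congr rfl fun v _ => ?_
    rw [← sum_filter, sum_const, smul_eq_mul, mul_comm]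
  rw [step1, ← mul_add, ← sum_add_distrib]
  -- Step 2: `#{r<k : kv<hr} + [kv/h] = k − 1` for each `v < h`
  have step2 : ∀ v ∈ range h,
      v * ((range k).filter (fun r => k * v < h * r)).card + v * (k * v / h) = v * (k - 1) := by
    intro v hv
    have := card_filter_lt_add hh hk (mem_range.mp hv)
    rw [← mul_add]
    congr 1
    omega
  rw [sum_congr rfl step2, ← sum_mul]
  have hg := sum_range_id_mul_two h
  calc 2 * ((∑ i ∈ range h, i) * (k - 1)) = (∑ i ∈ range h, i) * 2 * (k - 1) := by ring
    _ = h * (h - 1) * (k - 1) := by rw [hg]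

/-- **Reciprocity law for Dedekind sums — PROVED** (discharge of `DedekindSumReciprocity`), along
the arithmetic proof of Rademacher–Whiteman printed by Apostol (§3.8): evaluate `∑_r ((hr/k))²` in
two ways (the residues `hr mod k` permute `1, …, k−1`; eq. (32)–(33)), then collect the terms of
`∑_r [hr/k]([hr/k]+1)` by the value of `[hr/k]` (eq. (34)–(35), here `sum_floor_sq_add_floor`) and
combine with (30)/(36) for `s(h,k)` and `s(k,h)`. [cite: Apostol1990, Thm. 3.7 (proof, §3.8)]
[cite: RademacherGrosswald1972, Ch. 2 Thm. 1] -/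
theorem DedekindSumReciprocity_holds : DedekindSumReciprocity := by
  intro h k hh hk hc
  have hk' : (k : ℚ) ≠ 0 := by exact_mod_cast hk.ne'
  have hh' : (h : ℚ) ≠ 0 := by exact_mod_cast hh.ne'
  -- (36) for (h,k) and (k,h)
  have E1 := twelve_mul_dedekindSum hk hc
  have E2 := twelve_mul_dedekindSum hh hc.symm
  -- the residues ρ_r = hr mod k: ∑ ρ_r = ∑ r and ∑ ρ_r² = ∑ r² (permutation), ρ_r = hr − k[hr/k]
  have P1 : ∑ r ∈ range k, ((h * r % k : ℕ) : ℚ) = (k : ℚ) * ((k : ℚ) - 1) / 2 := by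
    rw [sum_mul_mod_eq hk hc (fun n => (n : ℚ)), sum_range_natCast]
  have P2 : ∑ r ∈ range k, ((h * r % k : ℕ) : ℚ) ^ 2 =
      (k : ℚ) * ((k : ℚ) - 1) * (2 * (k : ℚ) - 1) / 6 := by
    rw [sum_mul_mod_eq hk hc (fun n => (n : ℚ) ^ 2), sum_range_natCast_sq]
  have Hρ : ∀ r ∈ range k,
      ((h * r % k : ℕ) : ℚ) = (h : ℚ) * r - k * ((h * r / k : ℕ) : ℚ) := by
    intro r _
    linear_combination -natCast_mul_eq_div_add_mod h r k
  -- E5': ∑_r [hr/k] = (h−1)(k−1)/2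
  have E5 : ∑ r ∈ range k, ((h * r / k : ℕ) : ℚ) = ((h : ℚ) - 1) * ((k : ℚ) - 1) / 2 := by
    have e : ∑ r ∈ range k, ((h * r % k : ℕ) : ℚ) =
        h * ∑ r ∈ range k, (r : ℚ) - k * ∑ r ∈ range k, ((h * r / k : ℕ) : ℚ) := by
      rw [sum_congr rfl Hρ, sum_sub_distrib, mul_sum, mul_sum]
    rw [P1, sum_range_natCast] at e
    apply mul_left_cancel₀ hk'
    linear_combination e
  -- E3': (33)  h²·S₂ − 2hk·A + k²·B = S₂, divided by k
  have E3 : (h : ℚ) ^ 2 * (((k : ℚ) - 1) * (2 * (k : ℚ) - 1) / 6)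
      - 2 * h * (∑ r ∈ range k, (r : ℚ) * ((h * r / k : ℕ) : ℚ))
      + k * (∑ r ∈ range k, ((h * r / k : ℕ) : ℚ) ^ 2) = ((k : ℚ) - 1) * (2 * (k : ℚ) - 1) / 6 := by
    have e : ∑ r ∈ range k, ((h * r % k : ℕ) : ℚ) ^ 2 =
        (h : ℚ) ^ 2 * ∑ r ∈ range k, (r : ℚ) ^ 2
          - 2 * h * k * ∑ r ∈ range k, (r : ℚ) * ((h * r / k : ℕ) : ℚ)
          + (k : ℚ) ^ 2 * ∑ r ∈ range k, ((h * r / k : ℕ) : ℚ) ^ 2 := by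
      rw [sum_congr rfl fun r hr => by rw [Hρ r hr], mul_sum, mul_sum, mul_sum, ← sum_sub_distrib,
        ← sum_add_distrib]
      exact sum_congr rfl fun r _ => by ring
    rw [P2, sum_range_natCast_sq] at e
    apply mul_left_cancel₀ hk'
    linear_combination -e
  -- E4: the lattice-point count (35), cast to ℚ
  have E4 : (∑ r ∈ range k, ((h * r / k : ℕ) : ℚ) ^ 2) + (∑ r ∈ range k, ((h * r / k : ℕ) : ℚ))
      + 2 * (∑ v ∈ range h, (v : ℚ) * ((k * v / h : ℕ) : ℚ)) = h * ((h : ℚ) - 1) * ((k : ℚ) - 1) := by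
    have e := sum_floor_sq_add_floor hh hk hc
    have e' : (((∑ r ∈ range k, ((h * r / k) ^ 2 + h * r / k) + 2 * ∑ v ∈ range h, v * (k * v / h) :
        ℕ) : ℚ)) = ((h * (h - 1) * (k - 1) : ℕ) : ℚ) := by rw [e]
    push_cast [Nat.cast_sub hh, Nat.cast_sub hk, sum_add_distrib] at e'
    linear_combination e'
  -- assemble
  linear_combination (h : ℚ) * E1 + (k : ℚ) * E2 + 6 * E3 - 6 * (k : ℚ) * E4 + 6 * (k : ℚ) * E5

/-- The reciprocity law, usable form: for coprime `h, k > 0`,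
`12hk·s(h,k) + 12kh·s(k,h) = h² + k² − 3hk + 1`. [cite: Apostol1990, Thm. 3.7] -/
theorem dedekindSum_reciprocity {h k : ℕ} (hh : 0 < h) (hk : 0 < k) (hc : Nat.Coprime h k) :
    12 * (h : ℚ) * k * dedekindSum h k + 12 * (k : ℚ) * h * dedekindSum k h =
      (h : ℚ) ^ 2 + (k : ℚ) ^ 2 - 3 * h * k + 1 :=
  DedekindSumReciprocity_holds h k hh hk hc

/-- Rademacher–Grosswald's normalisation: `s(h,k) + s(k,h) = −¼ + (1/12)(h/k + 1/(hk) + k/h)` for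
coprime `h, k > 0`. [cite: RademacherGrosswald1972, Ch. 2 Thm. 1, eq. (4)] -/
theorem dedekindSum_add_dedekindSum_swap {h k : ℕ} (hh : 0 < h) (hk : 0 < k)
    (hc : Nat.Coprime h k) :
    dedekindSum h k + dedekindSum k h =
      -1 / 4 + 1 / 12 * ((h : ℚ) / k + 1 / ((h : ℚ) * k) + (k : ℚ) / h) :=
  DedekindSumReciprocity_holds.add_eq hh hk hc

end Reciprocity


/-! ### `Φ` is integer-valued on `SL₂(ℤ)` (Rademacher–Grosswald, Ch. 4 A, pp. 49–50, eq. (61)) -/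

section Integrality

open Finset

/-- The congruence behind eq. (61): for `ad − bc = 1`, `c ≠ 0`, `k = |c|`: `k ∣ a + d − 2·(6k·s(d,k))`,
i.e. `12|c|·s(d,|c|) ≡ a + d (mod |c|)` — from the reciprocity law and the denominator theorem,
as printed. [cite: RademacherGrosswald1972, Ch. 4 A, eq. (61)] -/
theorem natAbs_dvd_add_sub_twelve_mul_dedekindSum {a b c d : ℤ} (hdet : a * d - b * c = 1)
    (hc : c ≠ 0) :
    ∃ z : ℤ, 6 * (c.natAbs : ℚ) * dedekindSum d c.natAbs = z ∧ (c.natAbs : ℤ) ∣ a + d - 2 * z := by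
  set k : ℕ := c.natAbs with hkdef
  have hk : 0 < k := Int.natAbs_pos.mpr hc
  have hk0 : (k : ℤ) ≠ 0 := by exact_mod_cast hk.ne'
  -- reduce `d` modulo `k`
  set h₀ : ℤ := d % k with hh₀
  have h0nn : 0 ≤ h₀ := Int.emod_nonneg _ hk0
  set m : ℤ := d / k with hmdef
  have hdecomp : d = h₀ + k * m := (Int.emod_add_mul_ediv d k).symm
  set n₀ : ℕ := h₀.toNat with hn₀
  have hnat : (n₀ : ℤ) = h₀ := Int.toNat_of_nonneg h0nn
  -- coprimality of `d` and `c`, hence of `n₀` and `k`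
  have hcop_dc : IsCoprime d c := ⟨a, -b, by linear_combination hdet⟩
  have hsk : Int.sign c * (k : ℤ) = c := Int.sign_mul_natAbs c
  have hcop_dk : IsCoprime d (k : ℤ) := by
    have : IsCoprime d (Int.sign c * (k : ℤ)) := by rw [hsk]; exact hcop_dc
    exact this.of_mul_right_right
  have hcop_hk : IsCoprime h₀ (k : ℤ) := by
    rw [hdecomp] at hcop_dk
    exact IsCoprime.add_mul_left_left_iff.mp hcop_dk
  have hcop_n : Nat.Coprime n₀ k := Nat.isCoprime_iff_coprime.mp (by rw [hnat]; exact hcop_hk)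
  -- `s(d,k) = s(n₀,k)`
  have hs : dedekindSum d k = dedekindSum (n₀ : ℤ) k := by
    rw [hnat, hh₀, dedekindSum_emod]
  obtain ⟨z, hz⟩ := six_mul_dedekindSum_mem_int hk hcop_n
  refine ⟨z, by rw [hs]; exact_mod_cast hz, ?_⟩
  rcases Nat.eq_zero_or_pos n₀ with hn0 | hn0
  · -- `n₀ = 0` forces `k = 1`
    have hk1 : k = 1 := by rw [hn0] at hcop_n; exact (Nat.coprime_zero_left k).mp hcop_n
    rw [hk1]; simp
  · -- reciprocity for the coprime pair `(n₀, k)` and the denominator theorem for `s(k, n₀)`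
    have hrec := dedekindSum_reciprocity hn0 hk hcop_n
    obtain ⟨z', hz'⟩ := six_mul_dedekindSum_mem_int hn0 hcop_n.symm
    have hzz : 2 * (n₀ : ℤ) * z + 2 * k * z' = (n₀ : ℤ) ^ 2 + (k : ℤ) ^ 2 - 3 * n₀ * k + 1 := by
      have e : (2 * (n₀ : ℚ) * z + 2 * k * z' : ℚ) = (n₀ : ℚ) ^ 2 + (k : ℚ) ^ 2 - 3 * n₀ * k + 1 := by
        rw [← hz, ← hz']; linear_combination hrec
      exact_mod_cast e
    -- `k ∣ n₀ · (a + d − 2z)` by an explicit witness, then cancel `n₀` (coprime to `k`)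
    have hm : (n₀ : ℤ) = d + k * (-m) := by rw [hnat]; linear_combination -hdecomp
    have hmul : (n₀ : ℤ) * (a + d - 2 * z) =
        k * (b * Int.sign c + a * (-m) - d * (-m) - k * (-m) ^ 2 - k + 3 * n₀ + 2 * z') := by
      linear_combination (-1 : ℤ) * hzz - ((n₀ : ℤ) - a + k * (-m)) * hm + hdet - b * hsk
    have hdvd : (k : ℤ) ∣ (n₀ : ℤ) * (a + d - 2 * z) := ⟨_, hmul⟩
    have hcop' : IsCoprime (k : ℤ) (n₀ : ℤ) := by rw [hnat]; exact hcop_hk.symm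
    exact hcop'.dvd_of_dvd_mul_left hdvd

/-- **`Φ(M)` is an integer** ("The functional value `Φ(M)` is always an integer"): for integers with
`ad − bc = 1`, `Φ(a b; c d) ∈ ℤ`. Printed argument: `c = 0` forces `a = d = ±1`; for `c ≠ 0` the
reciprocity law and Thm. 2 give `12|c|·s(d,|c|) ≡ a + d (mod |c|)` (eq. (61)).
[cite: RademacherGrosswald1972, Ch. 4 A (after eq. (60)) and eq. (61)] -/
theorem rademacherPhi_mem_int {a b c d : ℤ} (hdet : a * d - b * c = 1) :
    ∃ n : ℤ, rademacherPhi a b c d = n := by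
  rcases eq_or_ne c 0 with hc | hc
  · subst hc
    have had : a * d = 1 := by linear_combination hdet
    rcases Int.eq_one_or_neg_one_of_mul_eq_one' had with ⟨-, hd⟩ | ⟨-, hd⟩
    · exact ⟨b, by simp [rademacherPhi, hd]⟩
    · exact ⟨-b, by simp [rademacherPhi, hd, div_neg]⟩
  · obtain ⟨z, hz, hdvd⟩ := natAbs_dvd_add_sub_twelve_mul_dedekindSum hdet hc
    have hk : 0 < c.natAbs := Int.natAbs_pos.mpr hc
    have hkq : (c.natAbs : ℚ) ≠ 0 := by exact_mod_cast hk.ne'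
    have hcq : (c : ℚ) ≠ 0 := by exact_mod_cast hc
    have hs : dedekindSum d c.natAbs = (z : ℚ) / (6 * c.natAbs) := by
      rw [eq_div_iff (by positivity)]; linear_combination hz
    have hdvd' : c ∣ a + d - 2 * z := Int.natAbs_dvd.mp hdvd
    -- `Φ = (a + d − 2z)/c` in both sign cases
    have hΦ : rademacherPhi a b c d = ((a + d - 2 * z : ℤ) : ℚ) / (c : ℚ) := by
      rw [rademacherPhi_of_c_ne_zero hc, hs]
      rcases lt_or_gt_of_ne hc with hneg | hpos
      · have hk' : ((c.natAbs : ℕ) : ℤ) = -c := Int.ofNat_natAbs_of_nonpos hneg.le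
        rw [Int.sign_eq_neg_one_of_neg hneg]
        have : (c.natAbs : ℚ) = -c := by
          rw [← Int.cast_natCast (R := ℚ) c.natAbs, hk']; simp
        rw [this]
        push_cast
        field_simp
        ring
      · have hk' : ((c.natAbs : ℕ) : ℤ) = c := Int.natAbs_of_nonneg hpos.le
        rw [Int.sign_eq_one_of_pos hpos]
        have : (c.natAbs : ℚ) = c := by
          rw [← Int.cast_natCast (R := ℚ) c.natAbs, hk']
        rw [this]
        push_cast
        field_simp
        ring
    exact ⟨(a + d - 2 * z) / c, by rw [hΦ, Int.cast_div hdvd' hcq]⟩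

/-- `Φ : SL₂(ℤ) → ℤ`: `Φ(M)` is an integer for every `M ∈ SL₂(ℤ)`.
[cite: RademacherGrosswald1972, Ch. 4 A (after eq. (60))] -/
theorem rademacherPhiSL_mem_int (M : SL(2, ℤ)) : ∃ n : ℤ, rademacherPhiSL M = n := by
  have hdet := Matrix.det_fin_two (M : Matrix (Fin 2) (Fin 2) ℤ)
  rw [M.det_coe] at hdet
  exact rademacherPhi_mem_int (a := M 0 0) (b := M 0 1) (c := M 1 0) (d := M 1 1)
    (by linear_combination -hdet)

/-- `Ψ_t(a b; c d) ∈ ℤ` for `ad − bc = 1`, `t ∣ c` (difference of two values of `Φ` on `SL₂(ℤ)`: the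
conjugate `(a, tb; c/t, d)` again has determinant `1`; `t = 0` is harmless in this rendering).
[cite: RademacherGrosswald1972, Ch. 4 A (after eq. (60))] -/
theorem eisensteinPsi_mem_int {t : ℕ} {a b c d : ℤ} (hdet : a * d - b * c = 1)
    (htc : (t : ℤ) ∣ c) : ∃ n : ℤ, eisensteinPsi t a b c d = n := by
  obtain ⟨n₁, h₁⟩ := rademacherPhi_mem_int hdet
  have hdet' : a * d - (t * b) * (c / t) = 1 := by
    rw [mul_comm (t : ℤ) b, mul_assoc, Int.mul_ediv_cancel' htc]; exact hdet
  obtain ⟨n₂, h₂⟩ := rademacherPhi_mem_int hdet'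
  exact ⟨n₁ - n₂, by rw [eisensteinPsi, h₁, h₂]; push_cast; ring⟩

/-- `Ψ_t(M) ∈ ℤ` for `M ∈ SL₂(ℤ)` with `t ∣ c_M`. [cite: RademacherGrosswald1972, Ch. 4 A (after eq. (60))] -/
theorem eisensteinPsiSL_mem_int {t : ℕ} {M : SL(2, ℤ)} (hM : (t : ℤ) ∣ M 1 0) :
    ∃ n : ℤ, eisensteinPsiSL t M = n := by
  have hdet := Matrix.det_fin_two (M : Matrix (Fin 2) (Fin 2) ℤ)
  rw [M.det_coe] at hdet
  exact eisensteinPsi_mem_int (a := M 0 0) (b := M 0 1) (c := M 1 0) (d := M 1 1)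
    (by linear_combination -hdet) hM

end Integrality

end Literature.NumberTheory.ModularForms
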